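import Literature.NumberTheory.Automorphic.SmoothCharacterAdditive
import HarnessLib

/-!
# Dimension counts of `K`-fixed vectors along short exact sequences: `dim V^K = dim A^K + dim B^K`, subrepresentations, quotients, lines
# (Bernstein–Zelevinsky 1976 §2.3 «`V ↦ V^K` is exact»; Casselman 1995 §2.1)

Topic `NumberTheory/Automorphic`; namespace `Representation` (dot-notation extensions, as the sibling files ★ `AdmissibleSubquotient`,
★ `SmoothCharacterAdditive`).  PROOF FILE: theorems only (no definition, no instance, no notation, no named fact, no `sorry`).

The TRACE form of the exactness of `V ↦ V^K` is ★ `Representation.levelTrace_eq_add_of_subrepresentation` (`Θ_K^V = Θ_K^N + Θ_K^{V⁄N}`, admissible `V`);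
this file records the DIMENSION form that K-type multiplicity computations consume (Iwahori∕parahoric-fixed vectors of the constituents of a
principal series, Euler–Poincaré traces `Σ_F (−1)^{dim F} dim σ^{U_F}` over Jordan–Hölder factors), under the weaker hypothesis «`V` smooth, `V^K`
finite-dimensional» (`k` a field of characteristic `0`, `K` compact; the surjectivity half is ★ `fixedPoints_le_map_of_surjective`, averaging over `K`).

* §1 `mem_fixedPoints_of_map_mem` (an INJECTIVE intertwiner reflects `K`-fixedness), `finrank_fixedPoints_le_of_injective`, `finrank_fixedPoints_eq_of_bijective`
  (isomorphic representations have the same `dim V^K`; no topology), `finrank_fixedPoints_le_of_surjective` (`V` smooth, `K` compact).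
* §2 **`finrank_fixedPoints_eq_add_of_exact`**: for intertwiners `i : A → V` injective, `q : V → B` surjective with `range i = ker q`, `V` smooth, `K` compact,
  `V^K` finite-dimensional: `dim V^K = dim A^K + dim B^K`; the subrepresentation∕quotient instance **`finrank_fixedPoints_eq_add_of_subrepresentation`**
  (`dim V^K = dim N^K + dim (V⁄N)^K`) and its two rearrangements `finrank_fixedPoints_quotientRep_eq_sub`, `finrank_fixedPoints_toRepresentation_eq_sub`.
* §3 ONE-DIMENSIONAL pieces: `finrank_fixedPoints_eq_ite_of_finrank_eq_one` (`dim L^S = 1` if `S` acts trivially on the line `L`, else `0`), and the two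
  «peel a character» counts `finrank_fixedPoints_quotientRep_eq_sub_ite` (`N` a line: `dim (V⁄N)^K = dim V^K − [K acts trivially on N]`) and
  `finrank_fixedPoints_toRepresentation_eq_sub_ite` (`V⁄N` a line) — e.g. `dim St^K = dim (i_B χ)^K − [ψ∘det trivial on K]` for a length-two principal
  series with the one-dimensional constituent `ψ∘det`.

## References
* [BernsteinZelevinsky1976] I. N. Bernstein, A. V. Zelevinsky, *Representations of the group GL(n,F) where F is a non-archimedean local field*,
  Russian Math. Surveys 31:3 (1976), §2.1–2.3 (Prop. 2.3: exactness of `V ↦ V^K`).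
* [Casselman1995] W. Casselman, *Introduction to the theory of admissible representations of 𝔭-adic reductive groups* (notes, 1995), §2.1
  (the projection `P_K`, Prop. 2.1.?: `V ↦ V^K` exact), §3 (Iwahori-fixed vectors).
* [Borel1976] A. Borel, *Admissible representations of a semi-simple group over a local field with vectors fixed under an Iwahori subgroup*,
  Invent. Math. 35 (1976), §3–§4 (the consumer: `dim` of Iwahori-fixed vectors of constituents).
-/

set_option autoImplicit false

noncomputable section

open Literature.RepresentationTheory.FiniteGroups

namespace Representation

/-! ## §1 Injective ∕ surjective intertwiners and `dim V^K` -/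

section Algebraic

variable {k G A V : Type*} [Field k] [Group G] [AddCommGroup A] [Module k A] [AddCommGroup V] [Module k V]
  {σ : Representation k G A} {ρ : Representation k G V}

/-- **An injective intertwiner reflects `K`-fixedness**: if `i` is an injective `G`-map and `i a ∈ V^K` then `a ∈ A^K`
(`i (σ g a) = ρ g (i a) = i a`). [cite: BernsteinZelevinsky1976, §2.1–2.3] -/
theorem mem_fixedPoints_of_map_mem (i : σ.IntertwiningMap ρ) (hi : Function.Injective i) (K : Subgroup G) {a : A}
    (ha : i a ∈ ρ.fixedPoints K) : a ∈ σ.fixedPoints K := by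
  rw [mem_fixedPoints] at ha ⊢
  intro g hg
  apply hi
  rw [i.isIntertwining, ha g hg]

/-- **`dim A^K ≤ dim V^K` along an injective intertwiner** (`V^K` finite-dimensional): `i` restricts to an injection `A^K → V^K`.
[cite: BernsteinZelevinsky1976, §2.1–2.3] -/
theorem finrank_fixedPoints_le_of_injective (i : σ.IntertwiningMap ρ) (hi : Function.Injective i) (K : Subgroup G)
    [FiniteDimensional k (ρ.fixedPoints K)] : Module.finrank k (σ.fixedPoints K) ≤ Module.finrank k (ρ.fixedPoints K) := by
  let iK : σ.fixedPoints K →ₗ[k] ρ.fixedPoints K :=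
    { toFun := fun a => ⟨i (a : A), map_mem_fixedPoints i K a.2⟩
      map_add' := fun a b => Subtype.ext (by simp only [Submodule.coe_add, map_add])
      map_smul' := fun c a => Subtype.ext (by simp only [Submodule.coe_smul, map_smul, RingHom.id_apply]) }
  have hiK : Function.Injective iK := fun a b h => Subtype.ext (hi (congrArg (fun x : ρ.fixedPoints K => (x : V)) h))
  exact LinearMap.finrank_le_finrank_of_injective hiK

/-- **Isomorphic representations have the same `dim V^K`**: a bijective intertwiner restricts to a linear isomorphism `A^K ≃ V^K` (no topology, no
finiteness). [cite: BernsteinZelevinsky1976, §2.1–2.3] -/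
theorem finrank_fixedPoints_eq_of_bijective (i : σ.IntertwiningMap ρ) (hi : Function.Bijective i) (K : Subgroup G) :
    Module.finrank k (σ.fixedPoints K) = Module.finrank k (ρ.fixedPoints K) := by
  let iK : σ.fixedPoints K →ₗ[k] ρ.fixedPoints K :=
    { toFun := fun a => ⟨i (a : A), map_mem_fixedPoints i K a.2⟩
      map_add' := fun a b => Subtype.ext (by simp only [Submodule.coe_add, map_add])
      map_smul' := fun c a => Subtype.ext (by simp only [Submodule.coe_smul, map_smul, RingHom.id_apply]) }
  have hiK : Function.Injective iK := fun a b h => Subtype.ext (hi.1 (congrArg (fun x : ρ.fixedPoints K => (x : V)) h))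
  have hsK : Function.Surjective iK := fun v => by
    obtain ⟨a, ha⟩ := hi.2 (v : V)
    refine ⟨⟨a, mem_fixedPoints_of_map_mem i hi.1 K (ha.symm ▸ v.2)⟩, Subtype.ext ha⟩
  exact (LinearEquiv.ofBijective iK ⟨hiK, hsK⟩).finrank_eq

end Algebraic

section Smooth

variable {k G V B : Type*} [Field k] [CharZero k] [Group G] [TopologicalSpace G] [IsTopologicalGroup G]
  [AddCommGroup V] [Module k V] [AddCommGroup B] [Module k B] {ρ : Representation k G V} {τ : Representation k G B}

/-- **`dim B^K ≤ dim V^K` along a surjective intertwiner from a SMOOTH `V`** (`K` compact, `V^K` finite-dimensional): `B^K = q(V^K)` by averaging over `K`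
(★ `map_fixedPoints_eq_of_surjective`). [cite: BernsteinZelevinsky1976, §2.3] [cite: Casselman1995, §2.1] -/
theorem finrank_fixedPoints_le_of_surjective (hρ : ρ.IsSmooth) (q : ρ.IntertwiningMap τ) (hq : Function.Surjective q) {K : Subgroup G}
    (hKc : IsCompact (K : Set G)) [FiniteDimensional k (ρ.fixedPoints K)] :
    Module.finrank k (τ.fixedPoints K) ≤ Module.finrank k (ρ.fixedPoints K) := by
  rw [← map_fixedPoints_eq_of_surjective hρ q hq hKc]
  exact Submodule.finrank_map_le _ _

end Smooth

/-! ## §2 `dim V^K = dim A^K + dim B^K` along a short exact sequence `A ↪ V ↠ B` -/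

section Exact

variable {k G A V B : Type*} [Field k] [CharZero k] [Group G] [TopologicalSpace G] [IsTopologicalGroup G]
  [AddCommGroup A] [Module k A] [AddCommGroup V] [Module k V] [AddCommGroup B] [Module k B]
  {σ : Representation k G A} {ρ : Representation k G V} {τ : Representation k G B}

/-- **EXACTNESS OF `V ↦ V^K` IN DIMENSIONS: `dim V^K = dim A^K + dim B^K`** for `G`-maps `i : A → V` injective, `q : V → B` surjective with `range i = ker q`,
`V` SMOOTH, `K` COMPACT and `V^K` finite-dimensional (then `A^K`, `B^K` are too).  The sequence `A^K ↪ V^K ↠ B^K` is exact: injectivity and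
`range = ker` are formal (`mem_fixedPoints_of_map_mem`), surjectivity is the averaging projector over the compact `K` on the smooth `V`
(★ `fixedPoints_le_map_of_surjective`); then rank–nullity. [cite: BernsteinZelevinsky1976, §2.3] [cite: Casselman1995, §2.1] -/
theorem finrank_fixedPoints_eq_add_of_exact (hρ : ρ.IsSmooth) (i : σ.IntertwiningMap ρ) (q : ρ.IntertwiningMap τ) (hi : Function.Injective i)
    (hq : Function.Surjective q) (hex : LinearMap.range i.toLinearMap = LinearMap.ker q.toLinearMap) {K : Subgroup G} (hKc : IsCompact (K : Set G))
    [FiniteDimensional k (ρ.fixedPoints K)] :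
    Module.finrank k (ρ.fixedPoints K) = Module.finrank k (σ.fixedPoints K) + Module.finrank k (τ.fixedPoints K) := by
  -- the two restricted maps
  let iK : σ.fixedPoints K →ₗ[k] ρ.fixedPoints K :=
    { toFun := fun a => ⟨i (a : A), map_mem_fixedPoints i K a.2⟩
      map_add' := fun a b => Subtype.ext (by simp only [Submodule.coe_add, map_add])
      map_smul' := fun c a => Subtype.ext (by simp only [Submodule.coe_smul, map_smul, RingHom.id_apply]) }
  let qK : ρ.fixedPoints K →ₗ[k] τ.fixedPoints K :=
    { toFun := fun v => ⟨q (v : V), map_mem_fixedPoints q K v.2⟩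
      map_add' := fun v w => Subtype.ext (by simp only [Submodule.coe_add, map_add])
      map_smul' := fun c v => Subtype.ext (by simp only [Submodule.coe_smul, map_smul, RingHom.id_apply]) }
  have hiK : Function.Injective iK := fun a b h => Subtype.ext (hi (congrArg (fun x : ρ.fixedPoints K => (x : V)) h))
  have hqK : Function.Surjective qK := by
    intro w
    obtain ⟨v, hv, hvw⟩ := fixedPoints_le_map_of_surjective hρ q hq hKc w.2
    exact ⟨⟨v, hv⟩, Subtype.ext hvw⟩
  have hexK : LinearMap.range iK = LinearMap.ker qK := by
    ext v
    constructor
    · rintro ⟨a, rfl⟩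
      rw [LinearMap.mem_ker]
      apply Subtype.ext
      change q (i (a : A)) = 0
      have : i (a : A) ∈ LinearMap.ker q.toLinearMap := hex ▸ ⟨(a : A), rfl⟩
      exact this
    · intro hv
      rw [LinearMap.mem_ker] at hv
      have hv' : (v : V) ∈ LinearMap.ker q.toLinearMap := congrArg Subtype.val hv
      rw [← hex] at hv'
      obtain ⟨a, ha⟩ := hv'
      have haK : a ∈ σ.fixedPoints K := mem_fixedPoints_of_map_mem i hi K (by rw [show i a = (v : V) from ha]; exact v.2)
      exact ⟨⟨a, haK⟩, Subtype.ext ha⟩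
  -- rank–nullity on `qK`, with `ker qK = range iK ≅ A^K` and `range qK = B^K`
  have hrn := LinearMap.finrank_range_add_finrank_ker qK
  rw [LinearMap.range_eq_top.2 hqK, finrank_top, ← hexK, LinearMap.finrank_range_of_inj hiK] at hrn
  omega

variable (ρ) in
/-- **`dim V^K = dim N^K + dim (V⁄N)^K`** for a subrepresentation `N` of a SMOOTH `V`, `K` compact, `V^K` finite-dimensional — §2 at the inclusion
`N ↪ V` (★ `Subrepresentation.subtypeIntertwiningMap`) and the quotient map `V ↠ V⁄N` (★ `Subrepresentation.mkQ`).  Trace form: ★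
`levelTrace_eq_add_of_subrepresentation`. [cite: BernsteinZelevinsky1976, §2.3] [cite: Casselman1995, §2.1] -/
theorem finrank_fixedPoints_eq_add_of_subrepresentation (hρ : ρ.IsSmooth) (N : Subrepresentation ρ) {K : Subgroup G} (hKc : IsCompact (K : Set G))
    [FiniteDimensional k (ρ.fixedPoints K)] :
    Module.finrank k (ρ.fixedPoints K) =
      Module.finrank k (N.toRepresentation.fixedPoints K) + Module.finrank k (N.quotientRep.fixedPoints K) := by
  refine finrank_fixedPoints_eq_add_of_exact hρ (Subrepresentation.subtypeIntertwiningMap N) N.mkQ Subtype.val_injective N.mkQ_surjective ?_ hKc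
  ext v
  rw [LinearMap.mem_ker, LinearMap.mem_range]
  constructor
  · rintro ⟨w, rfl⟩
    exact (N.mkQ_eq_zero_iff _).2 w.2
  · intro hv
    exact ⟨⟨v, (N.mkQ_eq_zero_iff v).1 hv⟩, rfl⟩

variable (ρ) in
/-- `dim (V⁄N)^K = dim V^K − dim N^K` (`V` smooth, `K` compact, `V^K` finite-dimensional). [cite: BernsteinZelevinsky1976, §2.3] [cite: Casselman1995, §2.1] -/
theorem finrank_fixedPoints_quotientRep_eq_sub (hρ : ρ.IsSmooth) (N : Subrepresentation ρ) {K : Subgroup G} (hKc : IsCompact (K : Set G))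
    [FiniteDimensional k (ρ.fixedPoints K)] :
    Module.finrank k (N.quotientRep.fixedPoints K) = Module.finrank k (ρ.fixedPoints K) - Module.finrank k (N.toRepresentation.fixedPoints K) := by
  rw [finrank_fixedPoints_eq_add_of_subrepresentation ρ hρ N hKc]
  omega

variable (ρ) in
/-- `dim N^K = dim V^K − dim (V⁄N)^K` (`V` smooth, `K` compact, `V^K` finite-dimensional). [cite: BernsteinZelevinsky1976, §2.3] [cite: Casselman1995, §2.1] -/
theorem finrank_fixedPoints_toRepresentation_eq_sub (hρ : ρ.IsSmooth) (N : Subrepresentation ρ) {K : Subgroup G} (hKc : IsCompact (K : Set G))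
    [FiniteDimensional k (ρ.fixedPoints K)] :
    Module.finrank k (N.toRepresentation.fixedPoints K) = Module.finrank k (ρ.fixedPoints K) - Module.finrank k (N.quotientRep.fixedPoints K) := by
  rw [finrank_fixedPoints_eq_add_of_subrepresentation ρ hρ N hKc]
  omega

end Exact

/-! ## §3 One-dimensional pieces: peeling a character off a length-two representation -/

section Line

variable {k G V : Type*} [Field k] [Group G] [AddCommGroup V] [Module k V]

/-- **Fixed vectors of a one-dimensional representation**: on a LINE `V`, the subspace `V^S` fixed by a subgroup `S ≤ G` has dimension `1` if `S` acts
trivially and `0` otherwise. [cite: BernsteinZelevinsky1976, §2.1–2.3] -/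
theorem finrank_fixedPoints_eq_ite_of_finrank_eq_one (ρ : Representation k G V) (hV : Module.finrank k V = 1) (S : Subgroup G)
    [Decidable (∀ g ∈ S, ρ g = 1)] : Module.finrank k (ρ.fixedPoints S) = if (∀ g ∈ S, ρ g = 1) then 1 else 0 := by
  haveI : FiniteDimensional k V := .of_finrank_eq_succ hV
  split_ifs with hS
  · have htop : ρ.fixedPoints S = ⊤ := by
      refine eq_top_iff.2 fun v _ => (ρ.mem_fixedPoints _ v).2 fun g hg => ?_
      rw [hS g hg, Module.End.one_apply]
    rw [htop, finrank_top, hV]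
  · have hne : ρ.fixedPoints S ≠ ⊤ := by
      intro htop
      apply hS
      intro g hg
      refine LinearMap.ext fun v => ?_
      have hv : v ∈ ρ.fixedPoints S := htop ▸ Submodule.mem_top
      rw [Module.End.one_apply]
      exact (ρ.mem_fixedPoints S v).1 hv g hg
    have hle : Module.finrank k (ρ.fixedPoints S) ≤ 1 := hV ▸ Submodule.finrank_le _
    have hne1 : Module.finrank k (ρ.fixedPoints S) ≠ 1 := fun h1 => hne (Submodule.eq_top_of_finrank_eq (h1.trans hV.symm))
    omega

variable [CharZero k] [TopologicalSpace G] [IsTopologicalGroup G] (ρ : Representation k G V)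

/-- **Peeling a one-dimensional SUBrepresentation**: if `N ≤ V` is a LINE (`V` smooth, `K` compact, `V^K` finite-dimensional) then
`dim (V⁄N)^K = dim V^K − 1` when `K` acts trivially on `N` and `dim (V⁄N)^K = dim V^K` otherwise.
[cite: BernsteinZelevinsky1976, §2.3] [cite: Casselman1995, §2.1] [cite: Borel1976, §3–§4] -/
theorem finrank_fixedPoints_quotientRep_eq_sub_ite (hρ : ρ.IsSmooth) (N : Subrepresentation ρ) (hN : Module.finrank k N.toSubmodule = 1)
    {K : Subgroup G} (hKc : IsCompact (K : Set G)) [FiniteDimensional k (ρ.fixedPoints K)] [Decidable (∀ g ∈ K, N.toRepresentation g = 1)] :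
    Module.finrank k (N.quotientRep.fixedPoints K) = Module.finrank k (ρ.fixedPoints K) - if (∀ g ∈ K, N.toRepresentation g = 1) then 1 else 0 := by
  rw [finrank_fixedPoints_quotientRep_eq_sub ρ hρ N hKc, finrank_fixedPoints_eq_ite_of_finrank_eq_one N.toRepresentation hN K]

/-- **Peeling a one-dimensional QUOTIENT**: if `V⁄N` is a LINE (`V` smooth, `K` compact, `V^K` finite-dimensional) then
`dim N^K = dim V^K − 1` when `K` acts trivially on `V⁄N` and `dim N^K = dim V^K` otherwise — e.g. `dim St^K = dim (i_B χ)^K − [ψ∘det|_K = 1]` when the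
Steinberg-type constituent is the kernel of `i_B χ ↠ ψ∘det`. [cite: BernsteinZelevinsky1976, §2.3] [cite: Casselman1995, §2.1] [cite: Borel1976, §3–§4] -/
theorem finrank_fixedPoints_toRepresentation_eq_sub_ite (hρ : ρ.IsSmooth) (N : Subrepresentation ρ) (hQ : Module.finrank k (V ⧸ N.toSubmodule) = 1)
    {K : Subgroup G} (hKc : IsCompact (K : Set G)) [FiniteDimensional k (ρ.fixedPoints K)] [Decidable (∀ g ∈ K, N.quotientRep g = 1)] :
    Module.finrank k (N.toRepresentation.fixedPoints K) = Module.finrank k (ρ.fixedPoints K) - if (∀ g ∈ K, N.quotientRep g = 1) then 1 else 0 := by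
  rw [finrank_fixedPoints_toRepresentation_eq_sub ρ hρ N hKc, finrank_fixedPoints_eq_ite_of_finrank_eq_one N.quotientRep hQ K]

end Line

end Representation

end
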